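import Summits.QuantumFields.YangMills.Theorems.UnitScaleTiltHalvingHSupURhoWindowsRho3Prelim
import HarnessLib

/-!
# Route `UnitScaleTilt`, crux K1 child «MinimiserStabilityRegPr» (stmt-QuantumFields-19200), registered stub `stub_halvingStep` (v10 `BirthV10`) —
# ★ THE `cB9` WINDOW FOR THE (1.59)-MERGE: `2(L·c⋆) + 8α₄ ≤ cB9` FROM THE SOCKET HAND'S SMALLNESS `hw`

Cell `ym3-torus` (HUMAN RULING D-0037: YM₃ on T³ is ladder rung R3 — NOT d = 4, NOT a mass gap, NOT the Clay problem), width seat `ym-ust-19200-w7` gen 6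
(row «BASE-LEAF», LEAD-H ★w5-19200 g6 H-NAMER WORD 10; SHAPE RULING «`SB9AllL`», LOCATE-159-MERGE #41 + LOCATE-H59TL-TOP 039d0f5e).
`--supports stmt-QuantumFields-19200 --as helper`; THEOREMS ONLY (0 `def`, 0 `sorry`); count-neutral; nothing here claims `H59TL`, the stub, the crux or the gap.

WHAT.  The v6 display's (1.59) family is read from lit ✓`B8LeafModelZd3.SockB9P3 L B₀ B₀β cB9 β len η m Ω Λs Λb`, whose guard is `α₀, α₂ ≤ cB9`.  At the
member the chart size is `α₂ := 2((F.P K).L·c⋆) + 8α₄` in the schedule's letters (`α₁ = 198((ρ′+M′+1)ε₀) + 27((ρ′+M′+1)ε₀)/(LB₀)`, `c⋆ = 5dLB₀(ε₀ + α₁)`,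
`B₀′ = 300·L·m₀·(B₀'H + 15L²BG·BR + 3BG·BR·B₂′)`, `m₀ = 3(M′+ρ′)+1`, `α₄ = 8B₀′(5dLB₀)(ε₀ + α₁)` — EXACTLY the equations (0) of ✓p655819
`HalvingHSupURhoWindowsRho3.exists_topCall_constants_of_rhoWindow₃`).  ★ `alpha2_le_cB9_of_hw`: under the bridge's hypotheses (incl. its smallness `hw` with the
factor `(1 + cB9⁻¹)`), `0 < 2(L·c⋆) + 8α₄ ≤ cB9` and `≤ 1`.  ARITHMETIC ONLY, by the bridge's own helper lemmas ✓`Y_letters`, ✓`budgets₃`, ✓`sizes`, ✓`letters₃`: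
`2(L·c⋆) + 8α₄ ≤ 4·10⁹·V₄` (`letters₃`), `4·10¹⁴·L⁶X₀²Y·n·(1 + cB9⁻¹)·s ≤ 1` (`budgets₃`), hence `(2(L·c⋆) + 8α₄)(1 + cB9⁻¹) ≤ 10⁻⁵`, so `· cB9⁻¹ ≤ 1`.
USE.  In the BASE-LEAF ∕ STEP-LEAF wrappers: after `obtain ⟨m₀, α₀, α₁, a₆₆, cstar, B₀', α₄, …, e0, eα₀, ea, e1, ec, eB, e4, …⟩ := exists_topCall_constants_of_rhoWindow₃ …
hw'`, call `alpha2_le_cB9_of_hw d L hd3 hL2 hB₀ hB₀'H hB₂' hBG hBR hcB9 M′ ρ′ hε₀ hw' e0 eα₀ e1 ec eB e4` BEFORE `subst`ing the letters.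

References: T. Bałaban, CMP **99** (1985) 75–102 [Balaban1985RegularSpaces] ((1.59) p.86, (1.61) p.86, Prop. 3 p.87); CMP **99** (1985) 389–434
[Balaban1985BackgroundPropagators] (Thm 3.3 p.399).  Elementary real arithmetic; our proof.
-/

set_option autoImplicit false

namespace Summit.QuantumFields.YangMills.Theorems.HalvingHSupURhoWindowCB9

open HalvingHSupURhoWindowsPrelim (Y_letters sizes)
open HalvingHSupURhoWindowsRho3Prelim (budgets₃ letters₃)

/-- ★ **THE `cB9` WINDOW** `0 < 2(L·c⋆) + 8α₄ ≤ cB9` (and `≤ 1`) from the socket hand's smallness with the `(1 + cB9⁻¹)` factor, in the letters (0) of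
✓`exists_topCall_constants_of_rhoWindow₃` — what the (1.59)-family socket `SockB9P3 … cB9 …` asks of the member's chart size `α₂ = 2(L·c⋆) + 8α₄`.
[cite: Balaban1985RegularSpaces, (1.59) p.86, Prop. 3 p.87] (elementary arithmetic; our proof) -/
theorem alpha2_le_cB9_of_hw (d L : ℕ) (hd : d = 3) (hL : 2 ≤ L)
    {B₀ B₀'H B₂' BG BR cB9 : ℝ} (hB₀ : 0 < B₀) (hB₀'H : 0 < B₀'H) (hB₂' : 0 ≤ B₂') (hBG : 0 ≤ BG) (hBR : 0 ≤ BR) (hcB9 : 0 < cB9)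
    (M' ρ' : ℕ) {ε₀ : ℝ} (hε₀ : 0 < ε₀)
    (hw : (10 : ℝ) ^ 29 * (L : ℝ) ^ 12 * (1 + B₀ + B₀⁻¹) ^ 2 * ((1 + B₀'H) * (1 + B₂') * (1 + BG) * (1 + BR)) ^ 5 * (1 + cB9⁻¹) *
      (((ρ' : ℝ) + M' + 1) ^ 3 * ε₀) ≤ 1)
    {m₀ : ℕ} {α₀ α₁ cstar B₀' α₄ : ℝ}
    (e0 : m₀ = 3 * (M' + ρ') + 1) (eα₀ : α₀ = ε₀)
    (e1 : α₁ = 198 * (((ρ' : ℝ) + M' + 1) * ε₀) + 27 * (((ρ' : ℝ) + M' + 1) * ε₀) / ((L : ℝ) * B₀))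
    (ec : cstar = 5 * d * L * B₀ * (α₀ + α₁))
    (eB : B₀' = 300 * (L : ℝ) * m₀ * (B₀'H + 15 * (L : ℝ) ^ 2 * BG * BR + 3 * BG * BR * B₂'))
    (e4 : α₄ = 8 * B₀' * (5 * (d : ℝ) * L * B₀) * (α₀ + α₁)) :
    0 < 2 * ((L : ℝ) * cstar) + 8 * α₄ ∧ 2 * ((L : ℝ) * cstar) + 8 * α₄ ≤ cB9 ∧ 2 * ((L : ℝ) * cstar) + 8 * α₄ ≤ 1 := by
  subst hd
  rw [eα₀] at ec e4
  -- letters (as in the bridge)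
  set ℓ : ℝ := (L : ℝ) with hℓdef
  have hℓ2 : (2 : ℝ) ≤ ℓ := by rw [hℓdef]; exact_mod_cast hL
  have hℓ1 : (1 : ℝ) ≤ ℓ := by linarith only [hℓ2]
  have hℓ0 : (0 : ℝ) ≤ ℓ := by linarith only [hℓ2]
  have hρ0 : (0 : ℝ) ≤ ρ' := Nat.cast_nonneg _
  have hM0 : (0 : ℝ) ≤ M' := Nat.cast_nonneg _
  obtain ⟨n, hn⟩ : ∃ n : ℝ, n = (ρ' : ℝ) + M' + 1 := ⟨_, rfl⟩
  have hn1 : 1 ≤ n := by rw [hn]; linarith only [hρ0, hM0]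
  have hn0 : 0 ≤ n := by linarith only [hn1]
  obtain ⟨s, hs⟩ : ∃ s : ℝ, s = n * ε₀ := ⟨_, rfl⟩
  have hs0 : 0 < s := by rw [hs]; positivity
  have hεs : ε₀ ≤ s := by rw [hs]; have := mul_nonneg (sub_nonneg.mpr hn1) hε₀.le; linarith only [this]
  obtain ⟨X₀, hX₀⟩ : ∃ X₀ : ℝ, X₀ = 1 + B₀ + B₀⁻¹ := ⟨_, rfl⟩
  obtain ⟨Y, hY⟩ : ∃ Y : ℝ, Y = (1 + B₀'H) * (1 + B₂') * (1 + BG) * (1 + BR) := ⟨_, rfl⟩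
  have hBinv0 : 0 < B₀⁻¹ := inv_pos.mpr hB₀
  have hX₀1 : 1 ≤ X₀ := by rw [hX₀]; linarith only [hB₀.le, hBinv0.le]
  have hX₀0 : 0 ≤ X₀ := by linarith only [hX₀1]
  have hB₀X : B₀ ≤ X₀ := by rw [hX₀]; linarith only [hBinv0.le]
  have hBiX : B₀⁻¹ ≤ X₀ := by rw [hX₀]; linarith only [hB₀.le]
  obtain ⟨hY1, -, -, -, -, -, -, hYlow⟩ := Y_letters hB₀'H.le hB₂' hBG hBR hY
  have hY0 : 0 ≤ Y := by linarith only [hY1]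
  obtain ⟨c, hc⟩ : ∃ c : ℝ, c = cB9⁻¹ := ⟨_, rfl⟩
  have hc0 : 0 ≤ c := by rw [hc]; exact (inv_pos.mpr hcB9).le
  have hW : (10 : ℝ) ^ 29 * ℓ ^ 12 * X₀ ^ 2 * Y ^ 5 * (1 + c) * (n ^ 2 * s) ≤ 1 := by
    have h : n ^ 2 * s = ((ρ' : ℝ) + M' + 1) ^ 3 * ε₀ := by rw [hs, hn]; ring
    rw [hX₀, hY, hc, h]; exact hw
  obtain ⟨-, hB3, -, -, -, -, -, -, -⟩ := budgets₃ hℓ1 hX₀1 hY1 hc0 hn1 hs0.le hW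
  -- the schedule letters in the bridge's base currency
  have hα₁' : α₁ = 198 * s + 27 * s / (ℓ * B₀) := by rw [hs, hn]; exact e1
  have hcs : cstar = 15 * ℓ * B₀ * (ε₀ + α₁) := by rw [ec]; push_cast; ring
  obtain ⟨B₀'b, hB₀'b⟩ : ∃ b : ℝ, b = B₀'H + 15 * ℓ ^ 2 * BG * BR + 3 * BG * BR * B₂' := ⟨_, rfl⟩
  obtain ⟨α₄b, hα₄b⟩ : ∃ a : ℝ, a = 8 * B₀'b * cstar := ⟨_, rfl⟩
  obtain ⟨cB, hcB⟩ : ∃ x : ℝ, x = ℓ * cstar := ⟨_, rfl⟩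
  obtain ⟨cDA, hcDA⟩ : ∃ x : ℝ, x = 3 * ℓ ^ 2 * cstar := ⟨_, rfl⟩
  obtain ⟨Clb, hClb⟩ : ∃ x : ℝ, x = 2 * 579944448 * (120 * cB + 2 * α₄b) := ⟨_, rfl⟩
  obtain ⟨-, -, hcsL, hcsU, hcs0, hbL1, hbL2, hbL3, hbU, hb0, -, -, -, -, -, -, -, -, -, -⟩ :=
    sizes hℓ1 hB₀ hX₀1 hB₀X hBiX hY1 hB₀'H hB₂' hBG hBR hYlow hs0 hε₀ hεs hα₁' hcs hB₀'b hα₄b hcB hcDA hClb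
  -- `m₀` and the ρ3 letters (with the idle letter `a := 0`)
  obtain ⟨m, hm⟩ : ∃ m : ℝ, m = (m₀ : ℝ) := ⟨_, rfl⟩
  have hmE : m = 3 * ((M' : ℝ) + ρ') + 1 := by rw [hm, e0]; push_cast; ring
  have hm1 : 1 ≤ m := by rw [hmE]; linarith only [hρ0, hM0]
  have hm3 : m ≤ 3 * n := by rw [hmE, hn]; linarith only [hρ0]
  have hB₀'2 : B₀' = 300 * ℓ * m * B₀'b := by rw [eB, hB₀'b, hm]
  have hα₄2 : α₄ = 8 * B₀' * cstar := by rw [e4, hcs]; push_cast; ring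
  obtain ⟨σ, hσ⟩ : ∃ x : ℝ, x = 2 * ℓ * (cstar + 0) := ⟨_, rfl⟩
  obtain ⟨δ, hδ⟩ : ∃ x : ℝ, x = 40 * ℓ * σ := ⟨_, rfl⟩
  obtain ⟨ω, hω⟩ : ∃ x : ℝ, x = 3 * ℓ * α₄ / 2 := ⟨_, rfl⟩
  obtain ⟨τ₀, hτ₀⟩ : ∃ t : ℝ, t = 16 * m * σ := ⟨_, rfl⟩
  obtain ⟨Cl, hCl⟩ : ∃ x : ℝ, x = 2 * 579944448 * (120 * cB + 2 * α₄) + 10240 * (3 * ℓ) * (α₄ + δ + 11 * ω) := ⟨_, rfl⟩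
  obtain ⟨Cb₂, hCb₂⟩ : ∃ x : ℝ, x = 640 * (α₄ + δ + 5 * ω) * ω := ⟨_, rfl⟩
  obtain ⟨-, -, hα₄0, -, -, -, -, -, -, -, -, -, -, -, htU, -, -, -, -, -, -, -, -, -, -, -, -, -⟩ :=
    letters₃ hℓ1 hX₀1 hY1 hBG hBR hB₂' hB₀'H hn1 hs0 hεs hm1 hm3 le_rfl (by positivity) hcs0 hcsL hcsU hb0 hbU hbL1 hbL2 hbL3 hB₀'2 hα₄2 hσ hδ hω hτ₀
      hcB hcDA hCl hCb₂
  -- the arithmetic: `t (1 + c) ≤ 10⁻⁵`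
  set t : ℝ := 2 * (ℓ * cstar) + 8 * α₄ with htdef
  have ht0 : 0 < t := by positivity
  have hV0 : 0 ≤ ℓ ^ 4 * X₀ * Y * n * s := by positivity
  have hB3' : 4 * 10 ^ 14 * ℓ ^ 6 * X₀ ^ 2 * Y * n * (1 + c) * s ≤ 1 := by
    have e : 10 ^ 12 * ℓ ^ 3 * X₀ ^ 2 * (400 * ℓ ^ 3 * n * Y) * (1 + c) * s = 4 * 10 ^ 14 * ℓ ^ 6 * X₀ ^ 2 * Y * n * (1 + c) * s := by ring
    linarith only [hB3, e]
  have hℓ2X : 1 ≤ ℓ ^ 2 * X₀ := one_le_mul_of_one_le_of_one_le (one_le_pow₀ hℓ1) hX₀1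
  have hA0 : 0 ≤ 4 * 10 ^ 9 * (ℓ ^ 4 * X₀ * Y * n * s) * (1 + c) := by positivity
  have hA : 4 * 10 ^ 9 * (ℓ ^ 4 * X₀ * Y * n * s) * (1 + c) ≤ 1 / 10 ^ 5 := by
    have h3 : 4 * 10 ^ 9 * (ℓ ^ 4 * X₀ * Y * n * s) * (1 + c) * 1 ≤ 4 * 10 ^ 9 * (ℓ ^ 4 * X₀ * Y * n * s) * (1 + c) * (ℓ ^ 2 * X₀) :=
      mul_le_mul_of_nonneg_left hℓ2X hA0
    have h4 : 4 * 10 ^ 9 * (ℓ ^ 4 * X₀ * Y * n * s) * (1 + c) * (ℓ ^ 2 * X₀) = (4 * 10 ^ 14 * ℓ ^ 6 * X₀ ^ 2 * Y * n * (1 + c) * s) / 10 ^ 5 := by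
      ring
    rw [h4, mul_one] at h3
    have h5 : (4 * 10 ^ 14 * ℓ ^ 6 * X₀ ^ 2 * Y * n * (1 + c) * s) / 10 ^ 5 ≤ 1 / 10 ^ 5 :=
      div_le_div_of_nonneg_right hB3' (by positivity)
    exact h3.trans h5
  have htc : t * (1 + c) ≤ 1 / 10 ^ 5 := (mul_le_mul_of_nonneg_right htU (by linarith only [hc0])).trans hA
  have ht1 : t ≤ 1 := by nlinarith only [htc, ht0, hc0]
  have htc1 : t * c ≤ 1 := by nlinarith only [htc, ht0, hc0]
  have ht9 : t ≤ cB9 := by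
    rw [hc, ← div_eq_mul_inv, div_le_one hcB9] at htc1
    exact htc1
  exact ⟨ht0, ht9, ht1⟩

end Summit.QuantumFields.YangMills.Theorems.HalvingHSupURhoWindowCB9
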